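import Summits.BirchSwinnertonDyer.Rank1Residual.X11b.Three.GoodReductionSubgroupCuspFrobenius
import Summits.BirchSwinnertonDyer.Rank1Residual.X11b.Three.GoodReductionSubgroupValuation
import HarnessLib

/-!
# X11b at `p = 3` (team N8/O2), JET3-KUMMER (α) at an ADDITIVE place: the `Ẽ_ns` half by
# additive Hilbert 90, and (α) PROVED at a presented cusp over a complete unramified layer

HONEST FRAMING (cell `b2b-bsdres`, run/shared/lean/b2b/bsd-rank1-residual/, verbatim in every
file): the goal of the cell is to DELETE the COMBINATION-SHAPED residual classes of the
Birch–Swinnerton-Dyer formula for ALL analytic-rank `≤ 1` elliptic curves over `ℚ` — "full BSD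
formula for every rank `≤ 1` curve in class `C`" assembled STRICTLY from published theorems — so
that the rank-`≤ 1` remainder becomes exactly the CONSTRUCTION-SHAPED classes, which are TYPED
(missing-input `Prop`s), NOT attempted. This is not "finishing BSD". Team N8/O2 = `x11b3`, seat
`b2b-bsdres-x11b3-p4` (owner of record of the S15 interface, LEAD DEAL #7 R7-7), S15 (v) "(α) at
ADDITIVE places", part 13 (assembly of parts 3, 7, 11, 12). THEOREMS ONLY: no definition, no named
fact, no `sorry`; nothing is booked; `JET@p|N` NOT discharged.

## What

* **`h1red_of_cusp`** — the `Ẽ_ns` half of (α) (the stub `h1red` of part 2's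
  `hα_of_cyclic_of_halves`, with `E₁ = E₁(L)`) HOLDS at a place where the `R`-model `W₀` of
  `X ⊗ L` reduces to a PRESENTED CUSP `singularModel x₀ y₀ α α` over the residue field `k`:
  hypotheses `hR` (all of `Aut(L/F)` preserves `R`), `R` henselian, `k` finite with `#k = qⁿ`,
  `φ` inducing `x ↦ x^q` on `k`. Mechanism: the cusp reduction map `r : E₀(L) →+ k` (part 12,
  kernel `E₁(L)`) is onto (Hensel: tree `exists_equation_residue_eq` + `cuspHom_surjective`),
  `r(φ P) = (r P)^q` (part 12, `hfrob`), and `H¹(⟨Frob_q⟩, k⁺) = 0` in cyclic form is ADDITIVE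
  HILBERT 90 (part 7 `exists_frob_sub_eq_of_sum_pow_eq_zero`); assembled by part 3's
  `h1red_of_reductionMap`. Silverman *AEC* VII.2.1, III.2.5(b); Serre *Local Fields* X §1.
* **`hα_of_h1ker_of_cusp`** — p1's hypothesis (α) of `JetchevKummerAtP` from the formal-group
  stub `h1ker` alone at such a place (`Gal = ⟨φ⟩`, `φⁿ = 1`).
* `cyclicH1_of_cusp_of_adicComplete`, **`hα_of_cusp_of_adicComplete`** — with `R` complete
  (`IsAdicComplete 𝔪 R`, hence henselian), a uniformiser of `R` from `F` and `X ⊗ L` elliptic, the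
  stub is discharged by part 11's `h1ker_of_adicComplete`: (α) is a THEOREM at every place with a
  presented cusp over a complete unramified layer (Milne *ADT* I Prop. 3.8 for `𝒜°` with additive
  special fibre, at a finite unramified level).
* `exists_baseChange_eq_add_pow_smul_of_cusp_of_adicComplete` — Jetchev's Prop. 4.1 at such a
  place (`T = ι(t₀ + p^m t₁)`, `t₀ ∈ E₀(K_v)`) modulo p1's (a), (b) and the cocycle ONLY.

RESIDUAL BINDERS (as in `S15-INTERFACE.md` §4, additive variant): `hR`, `[IsAdicComplete 𝔪 R]`,
`[Finite k]` + `hcard`, `φ`/`hφ`/`hn`/`hfrob`, uniformiser from `F`, `[IsGalois F L]` (end form),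
`[(X.baseChange L).IsMinimal R]` (minimality of the `K_v`-minimal model over the unramified layer
at an ADDITIVE place — NOT discharged here; Tate's algorithm under unramified base change), the
cusp PRESENTATION `hW` over `k` (from `HasAdditiveReduction` over a finite residue field — not
done here), `X ⊗ L` elliptic.

References (locators only; no new fact): [cite: MilneADT2006, Ch. I Prop. 3.8]
[cite: SilvermanAEC2009, VII.2 Prop. 2.1 (PDF p. 167), Prop. III.2.5(b) (PDF p. 59)]
[cite: SerreLocalFields1979, X §1 Prop. 1 (Hilbert 90), V §2] [cite: Jetchev2008, Prop. 4.1
(p. 819)].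

## Design

No definitions; `noncomputable section`; `open scoped Classical`. Axioms: `propext`,
`Classical.choice`, `Quot.sound`.
-/

noncomputable section

open scoped Classical

namespace Summit.BirchSwinnertonDyer.Rank1Residual.X11b.Three.JetchevKummer

open WeierstrassCurve Literature.NumberTheory.EllipticCurves

universe u

variable {F : Type u} [Field F] (X : WeierstrassCurve F) (L : Type u) [Field L] [Algebra F L]
  (R : Type*) [CommRing R] [IsDomain R] [IsDiscreteValuationRing R] [Algebra R L]
  [IsFractionRing R L] [(X.baseChange L).IsMinimal R] [Finite (IsLocalRing.ResidueField R)]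
  (W₀ : WeierstrassCurve R) (hX : X.baseChange L = W₀.baseChange L)

/-! ### §1 The `Ẽ_ns` half at a presented cusp -/

include hX in
/-- **The `Ẽ_ns` half of (α) at a place with a presented cusp** (the stub `h1red` of
`hα_of_cyclic_of_halves` HOLDS for `E₁ = E₁(L)`). Hypotheses: every `τ ∈ Aut(L/F)` preserves `R`
(`hR`); `W₀` an `R`-model of the `R`-minimal `X ⊗ L` (`hX`) with
`W₀ mod 𝔪 = singularModel x₀ y₀ α α` (a CUSP presented over the residue field `k`); `R` henselian,
`k` finite with `#k = qⁿ`; `φ ∈ Aut(L/F)` inducing `x ↦ x^q` on `k` (`hfrob`). Conclusion: every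
`m ∈ E₀(L)` with `Σ_{j<n} φʲ m = O` is `φ c − c` modulo `E₁(L)` for some `c ∈ E₀(L)`. The cusp
reduction map `r : E₀(L) ↠ k⁺` (kernel `E₁(L)`; onto by Hensel and `cuspHom` onto) satisfies
`r(φ P) = (r P)^q` (part 12), and `H¹` of `k⁺` for `x ↦ x^q` vanishes in cyclic form (ADDITIVE
Hilbert 90, part 7). Silverman *AEC* VII.2.1, III.2.5(b); Serre, *Local Fields* X §1.
[cite: SilvermanAEC2009, VII.2 Prop. 2.1 and Prop. III.2.5(b) (PDF pp. 167, 59)]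
[cite: SerreLocalFields1979, X §1 Prop. 1 (Hilbert 90)] -/
theorem h1red_of_cusp [HenselianRing R (IsLocalRing.maximalIdeal R)]
    (hR : ∀ (τ : L ≃ₐ[F] L) (x : L), x ∈ Set.range (algebraMap R L) →
      τ x ∈ Set.range (algebraMap R L))
    {x₀ y₀ α : IsLocalRing.ResidueField R}
    (hW : W₀.map (IsLocalRing.residue R) = singularModel x₀ y₀ α α)
    (φ : L ≃ₐ[F] L) {q n : ℕ} (hcard : Nat.card (IsLocalRing.ResidueField R) = q ^ n)
    (hfrob : ∀ a : R, ∃ a' : R, algebraMap R L a' = φ (algebraMap R L a) ∧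
      IsLocalRing.residue R a' = IsLocalRing.residue R a ^ q) :
    ∀ m ∈ (X.baseChange L).goodReductionSubgroup R, ∑ j ∈ Finset.range n, (φ ^ j) • m = 0 →
      ∃ c ∈ (X.baseChange L).goodReductionSubgroup R, m - (φ • c - c) ∈
        {Q : (X.baseChange L).toAffine.Point | ∀ (x y : L)
          (h : (X.baseChange L).toAffine.Nonsingular x y), Q = .some x y h →
            x ∉ Set.range (algebraMap R L)} := by
  have hv := integers_valuationRing_valuation R L
  have hinj : Function.Injective (algebraMap R L) := IsFractionRing.injective R L
  -- the cusp reduction map `r : E₀ → k` and its Galois behaviour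
  obtain ⟨r, hr0, hr⟩ := exists_addMonoidHom_of_map_eq_singularModel_cusp W₀ hv (K := L) hW
  obtain ⟨σk, hσres, hstable, -, -, -, hplus⟩ :=
    exists_residueMap_cuspReduction_smul X L R W₀ hX hR φ hW r hr0 hr
  -- `σ̄` is the `q`-Frobenius of `k`
  have hσk : ∀ x : IsLocalRing.ResidueField R, σk x = x ^ q := by
    intro x
    obtain ⟨a, rfl⟩ := IsLocalRing.residue_surjective x
    obtain ⟨a', ha', hres⟩ := hfrob a
    rw [hσres a a' ha', hres]
  -- the membership bridge and the transport `T : E₀ (Tamagawa) → E₀ (ReductionHomomorphism)`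
  have memiff := mem_goodReductionSubgroup_iff_hasNonsingularReduction_congrEquiv X L R W₀ hX
  let T : (X.baseChange L).goodReductionSubgroup R →+ W₀.nonsingularReductionSubgroup hv :=
    { toFun := fun b ↦ ⟨Affine.Point.congrEquiv hX (b : (X.baseChange L).toAffine.Point),
        (memiff _).mp b.2⟩
      map_zero' := Subtype.ext (by simp only [AddSubgroup.coe_zero, map_zero])
      map_add' := fun a b ↦ Subtype.ext (by simp only [AddSubgroup.coe_add, map_add]) }
  have hT : ∀ b : (X.baseChange L).goodReductionSubgroup R, (T b : (W₀.baseChange L).toAffine.Point) =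
      Affine.Point.congrEquiv hX (b : (X.baseChange L).toAffine.Point) := fun _ ↦ rfl
  let r' : (X.baseChange L).goodReductionSubgroup R →+ IsLocalRing.ResidueField R := r.comp T
  have hr' : ∀ b : (X.baseChange L).goodReductionSubgroup R, r' b = r (T b) := fun _ ↦ rfl
  -- the restriction of `φ` to `E₀(L)`
  let φB : (X.baseChange L).goodReductionSubgroup R →+ (X.baseChange L).goodReductionSubgroup R :=
    { toFun := fun b ↦ ⟨φ • (b : (X.baseChange L).toAffine.Point),
        smul_mem_goodReductionSubgroup X L R hR φ b.2⟩
      map_zero' := Subtype.ext (smul_zero φ)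
      map_add' := fun a b ↦ Subtype.ext (smul_add φ _ _) }
  have hφB : ∀ b : (X.baseChange L).goodReductionSubgroup R,
      ((φB b : (X.baseChange L).goodReductionSubgroup R) : (X.baseChange L).toAffine.Point) =
      φ • (b : (X.baseChange L).toAffine.Point) := fun _ ↦ rfl
  -- `r'` is surjective (Hensel + `cuspHom` onto)
  have hsurj : Function.Surjective r' := by
    intro t
    obtain ⟨Pt, hPt⟩ := singularModel.cuspHom_surjective (x₀ := x₀) (y₀ := y₀) (α := α) t
    rcases Pt with _ | ⟨xb, yb, hns⟩
    · refine ⟨0, ?_⟩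
      rw [map_zero, ← hPt]
      exact (map_zero _).symm
    · have hns' : (W₀.map (IsLocalRing.residue R)).toAffine.Nonsingular xb yb := by
        rw [hW]; exact hns
      obtain ⟨a, b, heq, hxa, hyb⟩ := W₀.exists_equation_residue_eq hns'
      have hnsab : (W₀.map (IsLocalRing.residue R)).toAffine.Nonsingular (IsLocalRing.residue R a)
          (IsLocalRing.residue R b) := by rw [hxa, hyb]; exact hns'
      have hnsab' : (singularModel x₀ y₀ α α).toAffine.Nonsingular (IsLocalRing.residue R a)
          (IsLocalRing.residue R b) := by rw [← hW]; exact hnsab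
      have h : (W₀.baseChange L).toAffine.Nonsingular (algebraMap R L a) (algebraMap R L b) :=
        W₀.nonsingular_baseChange_of_nonsingular_residue (K := L) heq hnsab
      have hP₀ : W₀.HasNonsingularReduction (.some _ _ h) :=
        (hasNonsingularReduction_some_algebraMap_iff hinj h).mpr hnsab
      have hb₀ : (Affine.Point.congrEquiv hX).symm (.some _ _ h) ∈
          (X.baseChange L).goodReductionSubgroup R := by
        rw [memiff, AddEquiv.apply_symm_apply]
        exact hP₀
      refine ⟨⟨_, hb₀⟩, ?_⟩
      have hTb : T ⟨_, hb₀⟩ = ⟨.some _ _ h, hP₀⟩ := Subtype.ext (AddEquiv.apply_symm_apply _ _)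
      rw [hr', hTb, ← hPt, hr a b h hnsab' hP₀, singularModel.cuspHom_apply]
      exact congrArg _ (point_some_congr hxa hyb)
  -- the kernel of `r'` consists of points reducing to `O`
  have hker : (r'.ker.map ((X.baseChange L).goodReductionSubgroup R).subtype :
      Set (X.baseChange L).toAffine.Point) ⊆
      {Q : (X.baseChange L).toAffine.Point | ∀ (x y : L)
        (h : (X.baseChange L).toAffine.Nonsingular x y), Q = .some x y h →
          x ∉ Set.range (algebraMap R L)} := by
    rintro _ ⟨b, hb, rfl⟩ x y h hbxy
    have hb' : r (T b) = 0 := hb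
    have h0 := (hr0 (T b)).mp hb'
    rw [hT, AddSubgroup.subtype_apply] at *
    rw [hbxy, Affine.Point.congrEquiv_some] at h0
    exact h0
  -- `r'` intertwines `φ` on `E₀(L)` with the Frobenius `σ̄` of `k`
  have hcomm : ∀ b, r' (φB b) = σk.toAddMonoidHom (r' b) := by
    intro b
    have hP : W₀.HasNonsingularReduction
        (Affine.Point.congrEquiv hX (b : (X.baseChange L).toAffine.Point)) := (memiff _).mp b.2
    have hσP : W₀.HasNonsingularReduction
        (Affine.Point.congrEquiv hX (φ • (b : (X.baseChange L).toAffine.Point))) :=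
      (memiff _).mp (φB b).2
    have e1 : r' b = r ⟨_, hP⟩ := rfl
    have e2 : r' (φB b) = r ⟨_, hσP⟩ := rfl
    rw [e1, e2, RingHom.toAddMonoidHom_eq_coe, AddMonoidHom.coe_coe]
    exact hplus _ hP hσP
  -- additive Hilbert 90 on `k` in cyclic form (part 7)
  have h90 : ∀ c : IsLocalRing.ResidueField R,
      ∑ j ∈ Finset.range n, (⇑(σk.toAddMonoidHom))^[j] c = 0 →
        ∃ c' : IsLocalRing.ResidueField R, σk.toAddMonoidHom c' - c' = c := by
    intro c hc
    rw [RingHom.toAddMonoidHom_eq_coe, AddMonoidHom.coe_coe] at hc ⊢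
    exact exists_frob_sub_eq_of_sum_pow_eq_zero σk hcard hσk c hc
  -- assemble (part 3)
  intro m hm hs
  obtain ⟨c, hcB, hc⟩ := h1red_of_reductionMap ((X.baseChange L).goodReductionSubgroup R)
    φB hφB σk.toAddMonoidHom r' hsurj hcomm h90 m hm hs
  exact ⟨c, hcB, hker hc⟩

include hX in
/-- **(α) from the formal-group stub alone, at a place with a presented cusp.** Under the
hypotheses of `h1red_of_cusp` and with `Gal(L/F) = ⟨φ⟩`, `φⁿ = 1`: if the formal-group half
`h1ker` holds on `E₁(L)`, then p1's hypothesis `hα` of `JetchevKummerAtP` holds: every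
`Q ∈ E(L)` with all `σ Q − Q ∈ E₀(L)` is congruent modulo `E₀(L)` to a `Gal(L/F)`-fixed point.
[cite: MilneADT2006, Ch. I Prop. 3.8] [cite: SilvermanAEC2009, VII.2 Prop. 2.1, Prop. III.2.5(b)] -/
theorem hα_of_h1ker_of_cusp [HenselianRing R (IsLocalRing.maximalIdeal R)]
    (hR : ∀ (τ : L ≃ₐ[F] L) (x : L), x ∈ Set.range (algebraMap R L) →
      τ x ∈ Set.range (algebraMap R L))
    {x₀ y₀ α : IsLocalRing.ResidueField R}
    (hW : W₀.map (IsLocalRing.residue R) = singularModel x₀ y₀ α α)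
    (φ : L ≃ₐ[F] L) (hφ : ∀ σ : L ≃ₐ[F] L, σ ∈ Subgroup.zpowers φ) {q n : ℕ} (hn : φ ^ n = 1)
    (hcard : Nat.card (IsLocalRing.ResidueField R) = q ^ n)
    (hfrob : ∀ a : R, ∃ a' : R, algebraMap R L a' = φ (algebraMap R L a) ∧
      IsLocalRing.residue R a' = IsLocalRing.residue R a ^ q)
    (h1ker : ∀ m ∈ {Q : (X.baseChange L).toAffine.Point | ∀ (x y : L)
        (h : (X.baseChange L).toAffine.Nonsingular x y), Q = .some x y h →
          x ∉ Set.range (algebraMap R L)},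
      ∑ j ∈ Finset.range n, (φ ^ j) • m = 0 →
        ∃ P ∈ {Q : (X.baseChange L).toAffine.Point | ∀ (x y : L)
          (h : (X.baseChange L).toAffine.Nonsingular x y), Q = .some x y h →
            x ∉ Set.range (algebraMap R L)}, φ • P - P = m) :
    ∀ Q : (X.baseChange L).toAffine.Point,
      (∀ σ : L ≃ₐ[F] L, σ • Q - Q ∈ (X.baseChange L).goodReductionSubgroup R) →
        ∃ Q' : (X.baseChange L).toAffine.Point, (∀ σ : L ≃ₐ[F] L, σ • Q' = Q') ∧
          Q - Q' ∈ (X.baseChange L).goodReductionSubgroup R :=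
  hα_of_cyclic_of_halves X L R φ hφ hn _
    (fun Q hQ ↦ mem_goodReductionSubgroup_of_reducesToZero X L R Q hQ) h1ker
    (h1red_of_cusp X L R W₀ hX hR hW φ hcard hfrob)

/-! ### §2 (α) at a presented cusp over a complete unramified layer — no stub -/

include hX in
/-- **`H¹(⟨φ⟩, E₀(L)) = 0` in cyclic form at a place with a presented cusp over a complete
unramified layer**: every `m ∈ E₀(L)` with `Σ_{j<n} φʲ m = O` is `φ P − P` with `P ∈ E₀(L)`
(`h1ker_of_adicComplete` + `h1red_of_cusp` + `cyclicH1_of_subset`). Milne, *ADT* I.3.8 for `𝒜°`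
with additive special fibre at a finite unramified level. [cite: MilneADT2006, Ch. I Prop. 3.8] -/
theorem cyclicH1_of_cusp_of_adicComplete [IsAdicComplete (IsLocalRing.maximalIdeal R) R]
    [(X.baseChange L).IsElliptic]
    (hR : ∀ (τ : L ≃ₐ[F] L) (x : L), x ∈ Set.range (algebraMap R L) →
      τ x ∈ Set.range (algebraMap R L))
    {x₀ y₀ α : IsLocalRing.ResidueField R}
    (hW : W₀.map (IsLocalRing.residue R) = singularModel x₀ y₀ α α)
    (φ : L ≃ₐ[F] L) {q n : ℕ} (hn : φ ^ n = 1)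
    (hcard : Nat.card (IsLocalRing.ResidueField R) = q ^ n)
    (hfrob : ∀ a : R, ∃ a' : R, algebraMap R L a' = φ (algebraMap R L a) ∧
      IsLocalRing.residue R a' = IsLocalRing.residue R a ^ q)
    {ϖ : R} (hϖ : Irreducible ϖ) {π : F} (hπ : algebraMap F L π = algebraMap R L ϖ) :
    ∀ m ∈ (X.baseChange L).goodReductionSubgroup R, ∑ j ∈ Finset.range n, (φ ^ j) • m = 0 →
      ∃ P ∈ (X.baseChange L).goodReductionSubgroup R, φ • P - P = m :=
  cyclicH1_of_subset ((X.baseChange L).goodReductionSubgroup R) _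
    (fun Q hQ ↦ mem_goodReductionSubgroup_of_reducesToZero X L R Q hQ) hn
    (h1ker_of_adicComplete X L R W₀ hX hR φ hn hcard hfrob hϖ hπ)
    (h1red_of_cusp X L R W₀ hX hR hW φ hcard hfrob)

include hX in
/-- **(α) at a presented cusp over a complete unramified layer — p1's hypothesis `hα` of
`JetchevKummerAtP` is a THEOREM here (no stub).** Hypotheses: `R` complete DVR of `L` with
finite residue field `k`, `#k = qⁿ`, all of `Gal = Aut(L/F)` preserving `R`, `Gal = ⟨φ⟩` with
`φⁿ = 1` and `φ ≡ (x ↦ x^q)` on `k`, a uniformiser of `R` from `F`, `X ⊗ L` elliptic with minimal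
`R`-model `W₀` reducing to the cusp `singularModel x₀ y₀ α α`.
[cite: MilneADT2006, Ch. I Prop. 3.8] [cite: SilvermanAEC2009, VII.2 Prop. 2.1, Prop. III.2.5(b)] -/
theorem hα_of_cusp_of_adicComplete [IsAdicComplete (IsLocalRing.maximalIdeal R) R]
    [(X.baseChange L).IsElliptic]
    (hR : ∀ (τ : L ≃ₐ[F] L) (x : L), x ∈ Set.range (algebraMap R L) →
      τ x ∈ Set.range (algebraMap R L))
    {x₀ y₀ α : IsLocalRing.ResidueField R}
    (hW : W₀.map (IsLocalRing.residue R) = singularModel x₀ y₀ α α)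
    (φ : L ≃ₐ[F] L) (hφ : ∀ σ : L ≃ₐ[F] L, σ ∈ Subgroup.zpowers φ)
    {q n : ℕ} (hn : φ ^ n = 1) (hcard : Nat.card (IsLocalRing.ResidueField R) = q ^ n)
    (hfrob : ∀ a : R, ∃ a' : R, algebraMap R L a' = φ (algebraMap R L a) ∧
      IsLocalRing.residue R a' = IsLocalRing.residue R a ^ q)
    {ϖ : R} (hϖ : Irreducible ϖ) {π : F} (hπ : algebraMap F L π = algebraMap R L ϖ) :
    ∀ Q : (X.baseChange L).toAffine.Point,
      (∀ σ : L ≃ₐ[F] L, σ • Q - Q ∈ (X.baseChange L).goodReductionSubgroup R) →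
        ∃ Q' : (X.baseChange L).toAffine.Point, (∀ σ : L ≃ₐ[F] L, σ • Q' = Q') ∧
          Q - Q' ∈ (X.baseChange L).goodReductionSubgroup R :=
  hα_of_h1ker_of_cusp X L R W₀ hX hR hW φ hφ hn hcard hfrob
    (h1ker_of_adicComplete X L R W₀ hX hR φ hn hcard hfrob hϖ hπ)

include hX in
/-- **Jetchev's Prop. 4.1 at a bad ADDITIVE place `v` with a presented cusp, modulo p1's inputs
(a), (b) and the cocycle ONLY**: `T = ι(t₀ + p^m t₁)` with `t₀ ∈ E₀(K_v)`, i.e.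
`T ∈ E₀(K_v) + p^m E(K_v)`. (α) and `hstab` of `JetchevKummerAtP` are discharged here; the flag
`JET@p|N` is NOT. [cite: Jetchev2008, Prop. 4.1 (p. 819)]
[cite: GrossLMS1991, Prop. 6.2 (1), pp. 244–245] [cite: MilneADT2006, Ch. I Prop. 3.8] -/
theorem exists_baseChange_eq_add_pow_smul_of_cusp_of_adicComplete [IsGalois F L]
    [IsAdicComplete (IsLocalRing.maximalIdeal R) R] [(X.baseChange L).IsElliptic]
    (R₀ : Type*) [CommRing R₀] [IsDomain R₀] [IsDiscreteValuationRing R₀] [Algebra R₀ F]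
    [IsFractionRing R₀ F] [Algebra R₀ R] [Algebra R₀ L] [IsScalarTower R₀ R L]
    [IsScalarTower R₀ F L] [IsLocalHom (algebraMap R₀ R)] [(X.baseChange F).IsMinimal R₀]
    (hR : ∀ (τ : L ≃ₐ[F] L) (x : L), x ∈ Set.range (algebraMap R L) →
      τ x ∈ Set.range (algebraMap R L))
    {x₀ y₀ α : IsLocalRing.ResidueField R}
    (hW : W₀.map (IsLocalRing.residue R) = singularModel x₀ y₀ α α)
    (φ : L ≃ₐ[F] L) (hφ : ∀ σ : L ≃ₐ[F] L, σ ∈ Subgroup.zpowers φ)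
    {q n : ℕ} (hn : φ ^ n = 1) (hcard : Nat.card (IsLocalRing.ResidueField R) = q ^ n)
    (hfrob : ∀ a : R, ∃ a' : R, algebraMap R L a' = φ (algebraMap R L a) ∧
      IsLocalRing.residue R a' = IsLocalRing.residue R a ^ q)
    {ϖ : R} (hϖ : Irreducible ϖ) {π : F} (hπ : algebraMap F L π = algebraMap R L ϖ)
    {p m n' : ℕ} (hcop : Nat.Coprime n' (p ^ m)) {U P T : (X.baseChange L).toAffine.Point}
    {Rσ : (L ≃ₐ[F] L) → (X.baseChange L).toAffine.Point}
    (hT : ∀ σ : L ≃ₐ[F] L, σ • T = T)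
    (hP : (n' : ℤ) • P ∈ (X.baseChange L).goodReductionSubgroup R)
    (hRσ : ∀ σ : L ≃ₐ[F] L, (n' : ℤ) • Rσ σ ∈ (X.baseChange L).goodReductionSubgroup R)
    (hU : ∀ σ : L ≃ₐ[F] L, σ • U - U = Rσ σ) (hpU : ((p ^ m : ℕ) : ℤ) • U = P - T) :
    ∃ t₀ t₁ : (X.baseChange F).toAffine.Point,
      t₀ ∈ (X.baseChange F).goodReductionSubgroup R₀ ∧
      T = Affine.Point.baseChange (W' := X.toAffine) F L (t₀ + ((p ^ m : ℕ) : ℤ) • t₁) :=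
  exists_baseChange_eq_add_pow_smul X L R₀ R
    (fun σ _ hQ ↦ smul_mem_goodReductionSubgroup X L R hR σ hQ)
    (hα_of_cusp_of_adicComplete X L R W₀ hX hR hW φ hφ hn hcard hfrob hϖ hπ)
    hcop hT hP hRσ hU hpU

end Summit.BirchSwinnertonDyer.Rank1Residual.X11b.Three.JetchevKummer

end
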